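import Literature.IUT.HodgeArakelov.PlusMinusTowerStableCurveBridgeH25Datum
import Literature.IUT.HodgeTheaters.TemperedCoveringsProSigmaInertia
import Literature.IUT.HodgeArakelov.LabelClassesOfCuspsR2
import HarnessLib

/-!
# Bridge B13, input (A) of [IUTchII] Cor 2.4 (i): the pro-`Σ` datum from "`I_x ≅ Ẑ(1)`" BY NAME

Mochizuki, *Inter-universal Teichmüller Theory I*, kurims manuscript (May 2020), §2, proof of Cor 2.5, p.51: "when
`x` is a cusp of `X` [so `I_x ≅ Ẑ`], it follows — i.e., by applying Proposition 2.4, (i), to the unique maximal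
pro-`Σ` subgroup of `I_x` — that …"; *Inter-universal Teichmüller Theory II*, kurims (Dec. 2020), §2, Cor 2.4 (i)
pp.69–71 [cite: Mochizuki2012, I Cor 2.5 p.51, II Cor 2.4 (i) pp.69–71] (D-0012 claim key, status disputed;
PROOF-ONLY companion of `PlusMinusTowerStableCurveBridgeH25` / `…H25Datum` (abc-iut-w5-d121, p413689 / p414707)
— no definition, nothing of the series is asserted).

abc-iut-L5-t11's `TemperedCoveringsProSigmaInertia` (p414896) derives, from an identification
`e : I_x ≃ₜ* Ẑ` of each representative cusp inertia group with `Ẑ` (the shape of the [SemiAnbd] §6 interface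
field `TemperedCurve.inertia_equiv_zHat`; print [IUTchI] p.51 "so `I_x ≅ Ẑ`"), that EVERY finite-index subgroup
of `I_x` contains a nontrivial compact pro-`Σ` subgroup (`proSigmaAtom_le_of_finiteIndex_of_equiv_zHat`).  This file
feeds that into route 2 of the B13 bridge: the binder `h25` of abc-iut-w4-d012's `cor24_i_of_inputs` (and the
inputs (A1)/(A2) of `cor24_i'_of_inputs'`) AT THE NODE'S `Π_v`-cuspidal `I_t`, from the B13 agreement, [IUTchI]
Prop 2.4 (i)/(iii) (`D.Prop24i`, `D.Prop24iii`), the second sentence of [IUTchII] Def 2.3 (ii) p.68 ("the cuspidal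
inertia groups of `Π_⊆` may be obtained as the intersections with `Π_⊆` of those cuspidal inertia groups of `Π_⊇` that
contain a finite index subgroup that lies inside `Π_⊆`" — as the MINIMAL clause `hrel₂`, or from abc-iut-L6-t19's
REPAIRED named statement `Def23_ii' C W.piV W.piPM` of `LabelClassesOfCuspsR2`; NOT abc-iut-L6-t1's original
`Def23_ii`, whose third conjunct is refuted at the model — finding of abc-iut-w5-d132 on p413689/p414707, repair file
`PlusMinusTowerStableCurveBridgeH25R`) and "`I_x ≅ Ẑ`" (`e`) — all HYPOTHESES BY NAME; the pro-`Σ` datum of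
p413689/p414707 is thereby DISCHARGED from `e`.
HONEST FRAMING: kernel checks of deductions between typed statements; typed ≠ proved; nothing here bears on
[IUTchIII] Cor 3.12.
-/

namespace Literature.IUT.HodgeArakelov

open Literature.IUT.HodgeTheaters
open Literature.AnabelianGeometry.AbsoluteAnabelian (IsNormallyTerminal)
open Literature.AnabelianGeometry.SemiGraphs (IsProSigma)
open scoped Pointwise

universe u

variable {S : BadPlaceSetting.{u}} {P : TopGroup.{u}} {T : TemperedCoverings S P}

namespace PlusMinusTower

namespace StableCurveAgreement

variable {W : PlusMinusTower T} {C : CuspidalInertiaData W} {D : StableCurveTemperedData.{u}}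

/-- **IUTchI:Cor2.5** (kurims p.51) **Input (A1) of [IUTchII] Cor 2.4 (i) at the node's `Π_v`-cuspidal inertia group, from
"`I_x ≅ Ẑ`".**  As `inputA1_of_prop24i` / `inputA1_of_proSigmaPart`, with the pro-`Σ` datum DISCHARGED by
abc-iut-L5-t11's `proSigmaAtom_le_of_finiteIndex_of_equiv_zHat` from `e : ∀ x, I_x ≃ₜ* Ẑ`: for a cuspidal inertia
group `I ⊆ Π_v` of `Π_v` and `γ ∈ Π̂^±_v`, `I ⊆ (Π^±_v)^γ ⟹ (Π^±_v)^γ = Π^±_v`.  HYPOTHESES (named, none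
asserted): the B13 agreement, `D.Prop24i`, `Def23_ii C W.piV W.piPM`, `e`. PROVED. [claim: Mochizuki2012, status: disputed] -/
theorem inputA1_of_equiv_zHat (A : StableCurveAgreement W C D) (h24i : D.Prop24i)
    (hrel₂ : ∀ I, C.IsCuspidalInertia W.piV I →
      ∃ I', C.IsCuspidalInertia W.piPM I' ∧ ((I' ⊓ W.piV).subgroupOf I').FiniteIndex ∧ I = I' ⊓ W.piV)
    (e : ∀ x : D.Cusp, ↥(D.inertiaTp x) ≃ₜ* ZHat)
    {I : Subgroup W.Corhat} (hI : C.IsCuspidalInertia W.piV I) :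
    ∀ γ : W.Corhat, γ ∈ W.pmHat → I ≤ W.piPM.map (MulAut.conj γ).toMonoidHom →
      W.piPM.map (MulAut.conj γ).toMonoidHom = W.piPM := by
  intro γ hγ hc
  -- Def 2.3 (ii): `I = I' ∩ Π_v`, finite index in a cuspidal inertia group `I'` of `Π^±_v`
  obtain ⟨I', hI', hfi, rfl⟩ := hrel₂ I hI
  -- the agreement: `I' ⊆ Π^±_v` is carried onto a `Π^tp_{X_v}`-conjugate of some `I_x`
  obtain ⟨hI'pm, x, t, hK⟩ := (A.inertia_iff I').mp hI'
  have hI'hat : I' ≤ W.pmHat := hI'pm.trans W.emb_le_pmHat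
  set g : D.PiHat := A.eHat ⟨γ, hγ⟩ with hg
  -- the homomorphism `d ↦ ι(t d t⁻¹)` on `Δ^tp_{X_v}`
  set f : D.DeltaTp →* D.PiHat := (D.ιX.comp (MulAut.conj t).toMonoidHom).comp D.DeltaTp.subtype with hf
  have hKf : (MulAut.conj t • (D.inertiaTp x).map D.DeltaTp.subtype).map D.ιX = (D.inertiaTp x).map f := by
    ext y
    simp only [hf, Subgroup.mem_map, MonoidHom.coe_comp, Function.comp_apply, Subgroup.coe_subtype,
      MulEquiv.coe_toMonoidHom, MulAut.conj_apply, Subgroup.mem_pointwise_smul_iff_inv_smul_mem,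
      MulAut.smul_def, MulAut.conj_inv_apply]
    constructor
    · rintro ⟨z, ⟨p, hp, hpz⟩, rfl⟩
      refine ⟨p, hp, ?_⟩
      have e' : (p : D.PiTp) = t⁻¹ * z * t := hpz
      rw [e']; congr 1; group
    · rintro ⟨p, hp, rfl⟩
      exact ⟨t * (p : D.PiTp) * t⁻¹, ⟨p, hp, by group⟩, rfl⟩
  set J : Subgroup D.PiHat := ((I' ⊓ W.piV).subgroupOf W.pmHat).map A.eHat.toMonoidHom with hJ
  -- `J ⊆ f(I_x)`, of finite index
  have hJfi : J.relIndex ((D.inertiaTp x).map f) ≠ 0 := by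
    rw [← hKf, hJ, ← hK, Subgroup.relIndex_map_map_of_injective _ _ A.eHat.injective,
      Subgroup.relIndex_subgroupOf hI'hat]
    exact hfi.index_ne_zero
  -- `J ⊆ (Π^tp_{X_v})^g`
  have hJg : J ≤ MulAut.conj g • D.ιX.range := by
    rintro _ ⟨q, hq, rfl⟩
    have hqI : (q : W.Corhat) ∈ I' ⊓ W.piV := Subgroup.mem_subgroupOf.mp hq
    have hq' : γ⁻¹ * (q : W.Corhat) * γ ∈ W.piPM := by
      have := hc hqI
      rwa [Subgroup.mem_map_equiv, MulAut.conj_symm_apply] at this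
    rw [Subgroup.mem_pointwise_smul_iff_inv_smul_mem, MulAut.smul_def, MulAut.conj_inv_apply,
      MulEquiv.coe_toMonoidHom, hg, ← A.eHat_conj_inv hγ q.2]
    exact (A.mem_piPM_iff ⟨_, _⟩).mp hq'
  -- pull `J` back to a finite-index subgroup `J₀` of `I_x`, take its pro-`Σ` part (from `I_x ≅ Ẑ`)
  set J₀ : Subgroup ↥(D.inertiaTp x) := (J.comap f).subgroupOf (D.inertiaTp x) with hJ₀
  haveI : J₀.FiniteIndex := by
    refine ⟨?_⟩
    change (J.comap f).relIndex (D.inertiaTp x) ≠ 0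
    rw [Subgroup.relIndex_comap]
    exact hJfi
  obtain ⟨Q, hQle, hQc, hQne, hQS⟩ := D.proSigmaAtom_le_of_finiteIndex_of_equiv_zHat (e x) J₀
  have hQJ : Q.map f ≤ J := by
    rintro _ ⟨q, hq, rfl⟩
    obtain ⟨z, hz, hzq⟩ := hQle hq
    have hz' : ((z : D.DeltaTp)) ∈ J.comap f := Subgroup.mem_subgroupOf.mp hz
    rw [← hzq]
    exact hz'
  have hQf : (MulAut.conj t • Q.map D.DeltaTp.subtype).map D.ιX = Q.map f := by
    ext y
    simp only [hf, Subgroup.mem_map, MonoidHom.coe_comp, Function.comp_apply, Subgroup.coe_subtype,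
      MulEquiv.coe_toMonoidHom, MulAut.conj_apply, Subgroup.mem_pointwise_smul_iff_inv_smul_mem,
      MulAut.smul_def, MulAut.conj_inv_apply]
    constructor
    · rintro ⟨z, ⟨p, hp, hpz⟩, rfl⟩
      refine ⟨p, hp, ?_⟩
      have e' : (p : D.PiTp) = t⁻¹ * z * t := hpz
      rw [e']; congr 1; group
    · rintro ⟨p, hp, rfl⟩
      exact ⟨t * (p : D.PiTp) * t⁻¹, ⟨p, hp, by group⟩, rfl⟩
  have heq : MulAut.conj g • D.ιX.range = D.ιX.range :=
    D.conj_range_eq_of_conj_proSigma_le h24i Q hQc hQne hQS t g (hQf ▸ hQJ.trans hJg)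
  exact (A.conj_piPM_eq_iff hγ).mpr heq

/-- **IUTchII:Cor2.4(i)** (kurims p.70 l.−3) **The binder `h25` of `cor24_i_of_inputs` at the node's `Π_v`-cuspidal `I`,
from "`I_x ≅ Ẑ`"**: for `γ' ∈ Δ̂^±_v`, `I^{γ'} ⊆ Π^±_v ⟹ γ' ∈ Π^±_v`.  HYPOTHESES: the B13 agreement,
`D.Prop24i`, normal terminality of `Π^tp_{X_v}` in `Π̂_{X_v}` (`hNT`), the Def 2.3 (ii) clause `hrel₂`,
`e : ∀ x, I_x ≃ₜ* Ẑ`. PROVED. [claim: Mochizuki2012, status: disputed] -/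
theorem h25_piV_of_equiv_zHat (A : StableCurveAgreement W C D) (h24i : D.Prop24i)
    (hNT : IsNormallyTerminal D.ιX.range)
    (hrel₂ : ∀ I, C.IsCuspidalInertia W.piV I →
      ∃ I', C.IsCuspidalInertia W.piPM I' ∧ ((I' ⊓ W.piV).subgroupOf I').FiniteIndex ∧ I = I' ⊓ W.piV)
    (e : ∀ x : D.Cusp, ↥(D.inertiaTp x) ≃ₜ* ZHat)
    {I : Subgroup W.Corhat} (hI : C.IsCuspidalInertia W.piV I) :
    ∀ γ' : W.Corhat, γ' ∈ W.pmHat ⊓ W.aug.ker →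
      I.map (MulAut.conj γ').toMonoidHom ≤ W.piPM → γ' ∈ W.piPM := by
  intro γ' hγ' hc
  have hγ'hat : γ'⁻¹ ∈ W.pmHat := W.pmHat.inv_mem (Subgroup.mem_inf.mp hγ').1
  have hI' : I ≤ W.piPM.map (MulAut.conj γ'⁻¹).toMonoidHom := by
    intro x hx
    rw [Subgroup.mem_map_equiv, MulAut.conj_symm_apply, inv_inv]
    exact hc ⟨x, hx, rfl⟩
  have hE := A.inputA1_of_equiv_zHat h24i hrel₂ e hI γ'⁻¹ hγ'hat hI'
  exact (Subgroup.inv_mem_iff W.piPM).mp (A.inputA2_of_normallyTerminal hNT γ'⁻¹ hγ'hat hE)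

/-- **IUTchII:Cor2.4(i)** (kurims pp.70–71) `h25_piV_of_equiv_zHat` with the normal terminality supplied by abc-iut-L5-t1's
typed [IUTchI] Prop 2.4 (iii) (`D.Prop24iii`): the binder `h25` from EXACTLY {B13 agreement, `D.Prop24i`,
`D.Prop24iii`, the Def 2.3 (ii) clause `hrel₂`, `I_x ≃ₜ* Ẑ`}. PROVED. [claim: Mochizuki2012, status: disputed] -/
theorem h25_piV_of_equiv_zHat_of_prop24iii (A : StableCurveAgreement W C D) (h24i : D.Prop24i)
    (h24iii : D.Prop24iii)
    (hrel₂ : ∀ I, C.IsCuspidalInertia W.piV I →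
      ∃ I', C.IsCuspidalInertia W.piPM I' ∧ ((I' ⊓ W.piV).subgroupOf I').FiniteIndex ∧ I = I' ⊓ W.piV)
    (e : ∀ x : D.Cusp, ↥(D.inertiaTp x) ≃ₜ* ZHat)
    {I : Subgroup W.Corhat} (hI : C.IsCuspidalInertia W.piV I) :
    ∀ γ' : W.Corhat, γ' ∈ W.pmHat ⊓ W.aug.ker →
      I.map (MulAut.conj γ').toMonoidHom ≤ W.piPM → γ' ∈ W.piPM :=
  A.h25_piV_of_equiv_zHat h24i h24iii.pi.isNormallyTerminal hrel₂ e hI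

/-- **IUTchII:Cor2.4(i)** (kurims pp.70–71) The binder `h25` of `cor24_i_of_inputs` at the node's `Π_v`-cuspidal `I` from the
REPAIRED named statement of [IUTchII] Def 2.3 (ii) (abc-iut-L6-t19's `Def23_ii' C W.piV W.piPM`,
`LabelClassesOfCuspsR2`; its conjunct 2 = the clause `hrel₂`), the B13 agreement, `D.Prop24i`, `D.Prop24iii` and
`I_x ≃ₜ* Ẑ` — all named typed statements, HYPOTHESES. PROVED. [claim: Mochizuki2012, status: disputed] -/
theorem h25_piV_of_equiv_zHat_of_def23ii' (A : StableCurveAgreement W C D) (h24i : D.Prop24i)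
    (h24iii : D.Prop24iii) (hrel' : Def23_ii' C W.piV W.piPM)
    (e : ∀ x : D.Cusp, ↥(D.inertiaTp x) ≃ₜ* ZHat)
    {I : Subgroup W.Corhat} (hI : C.IsCuspidalInertia W.piV I) :
    ∀ γ' : W.Corhat, γ' ∈ W.pmHat ⊓ W.aug.ker →
      I.map (MulAut.conj γ').toMonoidHom ≤ W.piPM → γ' ∈ W.piPM :=
  A.h25_piV_of_equiv_zHat_of_prop24iii h24i h24iii (fun J hJ => (hrel'.2.1 J).mp hJ) e hI

end StableCurveAgreement

end PlusMinusTower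

end Literature.IUT.HodgeArakelov
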